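import Summits.Ventures.HSemireg.ComponentLadderG2nCofinal
import Summits.Ventures.HSemireg.S4BridgeWeilReductionsMoonenZarhin
import Summits.HodgeConjecture.HodgeConjecture.Theorems.Ring2ClassTargetsRows
import HarnessLib

/-!
# Venture HSemireg — the ladder's TERMINUS below dimension 6 read through MOONEN–ZARHIN'S TWO PRINTED THEOREMS (Math. Ann. 315
# Thm. 0.1 ∕ Thm. 0.2, codimension-2 parts, vendored verbatim) instead of the combined sentence «Weil fourfolds ⟹ HC(dim ≤ 5)»

HONEST FRAMING. Assembly leaf of a COMPUTATION cell (`pub-hsemireg`, Sunday typer seat p11 «assembly, g = 2n», sixth generation; companion of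
`ComponentLadderG2nCofinal.lean` §3). Every published input is a hypothesis BY NAME — Deligne's reach-by-similitude `weilFamilyReach_similar`
(REFEREED named fact), the door-agnostic transfer statement `LocalVariationalHodgeFor 𝒪`, and Moonen–Zarhin's theorems
`MoonenZarhin1999_codimTwoHodgeClasses_abelianFourfold` (Math. Ann. 315 (1999) Thm. 0.1, codimension 2) and
`MoonenZarhin1999_codimTwoHodgeClasses_abelianFivefold` (Thm. 0.2, codimension 2), REFEREED named facts vendored verbatim in
`Literature/…/AbelianLowDimensionCodimTwoHodgeClasses.lean` — every object a hypothesis BY VALUE (seeds of class `𝒪` on Weil-type members); nothing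
here says HC, HC_CM or HC_AV is proved, and by the signed verdict (`target-g6/VERDICT-G6.md` v1.0 `1651dcc7322662a2`) NO census row supplies a seed
on any deciding component. THEOREMS ONLY (one-line compositions of tree theorems): 0 `sorry`, 0 `def`, 0 new named fact, no new axiom.

## Why this leaf (the S4 referee's precision P-2, carried into the assembly)

`ComponentLadderG2nCofinal` §3 and `ComponentLadderG2nOnePackage` §2 type the terminus of the p11 ladder below dimension 6 — HC for abelian
varieties of dimension `≤ 5` (`Theses.SevenfoldWeilCensus.HodgeAbelianDimLeFive`) — with ONE binder
`hMZ : MoonenZarhin1999_hodgeClasses_abelian_dim_le_five_of_weilClassesFourfolds`, whose NAME says Moonen–Zarhin but whose CONTENT is the printed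
COMBINED sentence «Weil classes on abelian fourfolds ⟹ HC in dimension ≤ 5» (Markman arXiv:2509.23403 Cor. 1.3; Voisin Exp. 1248 Cor. 2.8). Seat
s4-bridge-3's `S4BridgeWeilReductionsMoonenZarhin.lean` (answering `s4push/VERDICT-B3-TYPING-s4-bridge-3-2026-08-23.md` P-2) and ring 2's
`Ring2ClassTargetsRows.hodgeAbelianDimLeFive_iff_weilClassesFourfolds` carry the reduction on the two PRINTED theorems `h01`, `h02` instead (their
codimension-2 slices — WEAKER-OR-EQUAL hypotheses than print, delta (Δ1) of that file). HERE the p11 terminus rows are re-typed on `h01`, `h02`: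

§1 ONE seeded Weil-type member of ANY component at ANY level `N ≥ 3`, for every `d` ⟹ F1 (Markman's fourfold statement, re-derived) ∧ HC(dim ≤ 5) —
   both in the route item's spelling `HodgeAbelianDimLeFive` and as `HodgeConjectureFor A.dim A.X` for every complex abelian `A` with `A.dim ≤ 5`;
   COFINAL seeded members ⟹ the whole «consequences» tower R∞ ∧ F1 ∧ R1 ∧ R1′ ∧ R2 ∧ HC(dim ≤ 5); the companions' SPLIT-seed (S4-shape) clause as
   a special case.
§2 EXACTNESS for the cell's books: modulo `h01`, `h02` the FLOOR of the ladder (`∀ d > 0, WeilAlgebraicAll 2 d`) is EQUIVALENT to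
   `HodgeAbelianDimLeFive` — what ANY seed at ANY level buys below dimension 6 is exactly HC(dim ≤ 5), nothing in dimension ≥ 6 beyond the Weil-type
   components and their general members (`ComponentLadderG2nCofinal` §5).

AS-PRINTED (inherited from s4-bridge-3 ∕ lit-3 ∕ s4-bridge-lit, nothing newly read here): Thm. 0.1 parts (i)–(iv) cover EVERY abelian fourfold; Thm. 0.2
puts `B²` of a fivefold inside `D² + Σ_α α^*B²(fourfold quotients)`; the other codimensions are Lefschetz (1,1), hard Lefschetz and Poincaré duality
(tree theorems inside ring 2's `hcUpToDim_five_iff_weilClassesFourfolds`). In print: F1 ([Markman2025SurveySecant] Thm. 1.2 = arXiv:2502.03415 Cor. 1.6.1),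
hence HC(dim ≤ 5) (Cor. 1.3) — re-derived here as implications from seeds the census does not supply on any deciding component.

References: [MoonenZarhin1999LowDim] Thm. 0.1, Thm. 0.2 (arXiv:math/9901113 pp. 1–3) and (1.9); [Voisin2026BourbakiMarkman] Thm. 2.6, Cor. 2.8 (p. 15);
[Markman2025SurveySecant] §1.1, Thm. 1.2, Cor. 1.3, §11.5, §12 (preprint); [Markman2025SecantWeil] Thm. 1.5.1, Cor. 1.6.1 (preprint);
[Schoen1998HodgeWeilAddendum] 10 (Proposition), p. 332; [Deligne1982HodgeCycles] proof of Thm. 4.8; [vanGeemen1994HodgeAV] Lemma 5.2; [Weil1977HodgeRing] §3.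
-/

noncomputable section

open CategoryTheory CategoryTheory.Limits AlgebraicGeometry Set
open Literature.AlgebraicGeometry Literature.AlgebraicGeometry.Motives Literature.AlgebraicGeometry.Modules
open Literature.AlgebraicGeometry.HodgeTheory Literature.AlgebraicGeometry.KTheory Literature.AlgebraicGeometry.VanGeemen1994
open Literature.AlgebraicGeometry.ModuliOfAbelianVarieties Literature.AlgebraicGeometry.Deligne1982 Literature.AlgebraicTopology.SingularHomology

namespace Summit.Ventures.HSemireg

open Summit.HodgeConjecture.HodgeConjecture Summit.HodgeConjecture.HodgeConjecture.WeilTypeLadder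
open Summit.HodgeConjecture.HodgeConjecture.Cruxes.HodgeAbelianVarieties.EStepSecantInduction
open Summit.HodgeConjecture.HodgeConjecture.Cruxes.HodgeAbelianVarieties.PrymCanonicalZ3SplitSeeds.Stubs.WeilSectorOffReach
  (weilAlgebraicAll_two_iff_markman)
open Summit.HodgeConjecture.HodgeConjecture.Ring2.Hypotheses Summit.HodgeConjecture.HodgeConjecture.Ring2.AbelianAll
open Summit.HodgeConjecture.HodgeConjecture.Ring2.ClassTargets (hodgeAbelianDimLeFive_iff_weilClassesFourfolds)
open Summit.Ventures.HSemireg.GeneralStructure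
open Summit.Ventures.HSemireg.S4Bridge (hodgeConjectureFor_dim_le_five_of_weilAlgebraicAll_two_of_moonenZarhin)

/-! ## §1 The terminus below dimension 6 on Moonen–Zarhin Thm. 0.1 ∕ Thm. 0.2 BY NAME -/

section Terminus

variable {𝒪 : ObjClass}

/-- **The FLOOR from one seeded member per `d` at ANY level `N ≥ 3`**: reach-by-similitude ∧ `LocalVariationalHodgeFor 𝒪` ∧, for every `d > 0`, ONE seed
of class `𝒪` on SOME Weil-type `(N, d)` pair with `N ≥ 3` in a `K`-symmetrised hyperplane class (ANY component) ⟹ `WeilAlgebraicAll 2 d` for every `d`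
(every rational `(2,2)` Weil class of every `√-d`-Weil abelian fourfold — Markman's fourfold statement F1 per `d`, in print; here an implication from
seeds the census does not supply off the split components). [cite: Schoen1998HodgeWeilAddendum, 10 (Proposition), p. 332]
[cite: Markman2025SurveySecant, Thm. 1.2 and §11.5 Step 2 (preprint)] [cite: Deligne1982HodgeCycles, proof of Thm. 4.8] -/
theorem weilAlgebraicAll_two_of_reach_of_localVariationalHodgeFor_of_seededMembers_ge_three (hF : weilFamilyReach_similar)
    (hT : LocalVariationalHodgeFor 𝒪)
    (hS : ∀ d : ℕ, 0 < d → ∃ (N : ℕ) (P : AbelianVariety ℂ) (ψ₀ : P ⟶ P) (e : ProjectiveEmbedding P.X)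
      (a : complexBetti (projectiveSpace e.n ℂ) 2) (w : complexBetti P.X (2 * N)),
      3 ≤ N ∧ IsWeilType P ψ₀ N d ∧ IsRationalClass a ∧ a ≠ 0 ∧ w ∈ weilClassesOf P ψ₀ N d ∧ IsRationalClass w ∧ w ≠ 0 ∧
        HasSeedOn 𝒪 N P (symmetrisedClass d P ψ₀ e a) w)
    (d : ℕ) (hd : 0 < d) : WeilAlgebraicAll 2 d := by
  obtain ⟨N, P, ψ₀, e, a, w, hN, hW, haQ, ha0, hwW, hwQ, hw0, hSeed⟩ := hS d hd
  exact (below_of_localVariationalHodgeFor_of_seedOn_weilType hF hT hW e haQ ha0 hwW hwQ hw0 hSeed).2 2 two_pos (by omega)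

/-- **F1 ∧ HC(dim ≤ 5) on Moonen–Zarhin's two printed theorems BY NAME** (the as-printed form of `ComponentLadderG2nCofinal`'s
`floorFourfolds_and_dimLeFive_of_moonenZarhin_…_seededMembers_three`): BY NAME `h01` (Thm. 0.1, codimension 2: on every abelian FOURFOLD
`B² ⊆ D² + Σ_k W_k`), `h02` (Thm. 0.2, codimension 2: on every abelian FIVEFOLD `B² ⊆ D² + Σ_α α^* B²(fourfold quotients)`), the reach, the transfer
statement for `𝒪`; BY VALUE one seeded Weil-type member per `d` at any level `N ≥ 3`. CONCLUSION: Markman's fourfold statement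
`Markman2025_weilClasses_algebraic_abelianFourfold` (re-derived) ∧ the route item `Theses.SevenfoldWeilCensus.HodgeAbelianDimLeFive` ([Mar25b] Cor. 1.3 as an
implication; ring 2's `hodgeAbelianDimLeFive_iff_weilClassesFourfolds h01 h02`). NOT a new case of HC; nothing instantiated.
[cite: MoonenZarhin1999LowDim, Thm. 0.1 and Thm. 0.2 (arXiv:math/9901113 pp. 1–3)] [cite: Markman2025SurveySecant, Thm. 1.2 and Cor. 1.3 (preprint)]
[cite: Voisin2026BourbakiMarkman, Thm. 2.6 and Cor. 2.8 (p. 15)] [cite: Schoen1998HodgeWeilAddendum, 10 (Proposition), p. 332] -/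
theorem floorFourfolds_and_dimLeFive_of_moonenZarhinThms_of_reach_of_localVariationalHodgeFor_of_seededMembers_ge_three
    (h01 : MoonenZarhin1999_codimTwoHodgeClasses_abelianFourfold) (h02 : MoonenZarhin1999_codimTwoHodgeClasses_abelianFivefold)
    (hF : weilFamilyReach_similar) (hT : LocalVariationalHodgeFor 𝒪)
    (hS : ∀ d : ℕ, 0 < d → ∃ (N : ℕ) (P : AbelianVariety ℂ) (ψ₀ : P ⟶ P) (e : ProjectiveEmbedding P.X)
      (a : complexBetti (projectiveSpace e.n ℂ) 2) (w : complexBetti P.X (2 * N)),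
      3 ≤ N ∧ IsWeilType P ψ₀ N d ∧ IsRationalClass a ∧ a ≠ 0 ∧ w ∈ weilClassesOf P ψ₀ N d ∧ IsRationalClass w ∧ w ≠ 0 ∧
        HasSeedOn 𝒪 N P (symmetrisedClass d P ψ₀ e a) w) :
    Markman2025_weilClasses_algebraic_abelianFourfold ∧ Theses.SevenfoldWeilCensus.HodgeAbelianDimLeFive :=
  have hF1 : Markman2025_weilClasses_algebraic_abelianFourfold :=
    weilAlgebraicAll_two_iff_markman.1 (weilAlgebraicAll_two_of_reach_of_localVariationalHodgeFor_of_seededMembers_ge_three hF hT hS)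
  ⟨hF1, (hodgeAbelianDimLeFive_iff_weilClassesFourfolds h01 h02).2 hF1⟩

/-- **The same terminus in the summit's spelling `HodgeConjectureFor A.dim A.X` for every complex abelian `A` with `A.dim ≤ 5`** (s4-bridge-3's
`S4Bridge.hodgeConjectureFor_dim_le_five_of_weilAlgebraicAll_two_of_moonenZarhin` fed by §1's floor): Moonen–Zarhin Thm. 0.1 ∕ 0.2 BY NAME, the reach,
the transfer statement, one seeded member per `d` at any level `≥ 3`. CONDITIONAL throughout; no case of HC is proved here.
[cite: MoonenZarhin1999LowDim, Thm. 0.1 and Thm. 0.2] [cite: Voisin2026BourbakiMarkman, Cor. 2.8 (p. 15)] [cite: Markman2025SurveySecant, Cor. 1.3 (preprint)] -/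
theorem hodgeConjectureFor_dim_le_five_of_moonenZarhinThms_of_reach_of_localVariationalHodgeFor_of_seededMembers_ge_three
    (h01 : MoonenZarhin1999_codimTwoHodgeClasses_abelianFourfold) (h02 : MoonenZarhin1999_codimTwoHodgeClasses_abelianFivefold)
    (hF : weilFamilyReach_similar) (hT : LocalVariationalHodgeFor 𝒪)
    (hS : ∀ d : ℕ, 0 < d → ∃ (N : ℕ) (P : AbelianVariety ℂ) (ψ₀ : P ⟶ P) (e : ProjectiveEmbedding P.X)
      (a : complexBetti (projectiveSpace e.n ℂ) 2) (w : complexBetti P.X (2 * N)),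
      3 ≤ N ∧ IsWeilType P ψ₀ N d ∧ IsRationalClass a ∧ a ≠ 0 ∧ w ∈ weilClassesOf P ψ₀ N d ∧ IsRationalClass w ∧ w ≠ 0 ∧
        HasSeedOn 𝒪 N P (symmetrisedClass d P ψ₀ e a) w)
    (A : AbelianVariety ℂ) (hA : A.dim ≤ 5) : HodgeConjectureFor A.dim A.X :=
  hodgeConjectureFor_dim_le_five_of_weilAlgebraicAll_two_of_moonenZarhin h01 h02
    (weilAlgebraicAll_two_of_reach_of_localVariationalHodgeFor_of_seededMembers_ge_three hF hT hS) A hA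

/-- **The «consequences» tower from COFINAL seeded members on ANY components, Moonen–Zarhin Thm. 0.1 ∕ 0.2 BY NAME** (the as-printed form of
`ComponentLadderG2nCofinal.ladder_of_moonenZarhin_of_reach_of_localVariationalHodgeFor_of_cofinalSeededMembers`): R∞ `WeilClassesImaginaryQuadratic` ∧ F1
∧ R1 = stmt-2524 `WeilSixfolds` ∧ R1′ `NonsplitSixfolds` ∧ R2 `SplitWeilAbelianVarieties` — none of which uses Moonen–Zarhin — ∧ HC(dim ≤ 5)
`HodgeAbelianDimLeFive` through `h01`, `h02`. The CM-field rung and `HC_AV` are NOT reached; nothing instantiated (the census supplies nothing cofinal,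
nothing on a deciding component). [cite: MoonenZarhin1999LowDim, Thm. 0.1 and Thm. 0.2] [cite: Markman2025SurveySecant, Thm. 1.2, Cor. 1.3 and §12 (preprint)]
[cite: Weil1977HodgeRing, §3] [cite: Schoen1998HodgeWeilAddendum, 10 (Proposition), p. 332] -/
theorem ladder_of_moonenZarhinThms_of_reach_of_localVariationalHodgeFor_of_cofinalSeededMembers
    (h01 : MoonenZarhin1999_codimTwoHodgeClasses_abelianFourfold) (h02 : MoonenZarhin1999_codimTwoHodgeClasses_abelianFivefold)
    (hF : weilFamilyReach_similar) (hT : LocalVariationalHodgeFor 𝒪)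
    (hS : ∀ n : ℕ, 2 ≤ n → ∀ d : ℕ, 0 < d → ∃ (N : ℕ) (P : AbelianVariety ℂ) (ψ₀ : P ⟶ P) (e : ProjectiveEmbedding P.X)
      (a : complexBetti (projectiveSpace e.n ℂ) 2) (w : complexBetti P.X (2 * N)),
      n < N ∧ IsWeilType P ψ₀ N d ∧ IsRationalClass a ∧ a ≠ 0 ∧ w ∈ weilClassesOf P ψ₀ N d ∧ IsRationalClass w ∧ w ≠ 0 ∧
        HasSeedOn 𝒪 N P (symmetrisedClass d P ψ₀ e a) w) :
    WeilClassesImaginaryQuadratic ∧ Markman2025_weilClasses_algebraic_abelianFourfold ∧ Theses.SevenfoldWeilCensus.WeilSixfolds ∧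
      NonsplitSixfolds ∧ SplitWeilAbelianVarieties ∧ Theses.SevenfoldWeilCensus.HodgeAbelianDimLeFive := by
  have hR := weilClassesImaginaryQuadratic_of_reach_of_localVariationalHodgeFor_of_cofinalSeededMembers hF hT hS
  have hF1 := floorFourfolds_of_weilClassesImaginaryQuadratic hR
  exact ⟨hR, hF1, weilSixfolds_of_weilClassesImaginaryQuadratic hR, nonsplitSixfolds_of_weilClassesImaginaryQuadratic hR,
    splitWeilAbelianVarieties_of_weilClassesImaginaryQuadratic hR, (hodgeAbelianDimLeFive_iff_weilClassesFourfolds h01 h02).2 hF1⟩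

/-- **The companions' SPLIT-seed clause as a special case** (p5 ∕ p11 g0's (S4)-shape hypothesis «cofinal hyperbolic seeds of class `𝒪`», the
existence predicate of `StructureLadderG2n`): the same six-conjunct tower on Moonen–Zarhin Thm. 0.1 ∕ 0.2 BY NAME, via `ComponentLadderG2nCofinal`'s
`cofinalSeededMembers_of_cofinalHyperbolicSeedsOn`. [cite: MoonenZarhin1999LowDim, Thm. 0.1 and Thm. 0.2] [cite: Deligne1982HodgeCycles, proof of Thm. 4.8 with Prop. 4.4] -/
theorem ladder_of_moonenZarhinThms_of_reach_of_localVariationalHodgeFor_of_cofinalHyperbolicSeedsOn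
    (h01 : MoonenZarhin1999_codimTwoHodgeClasses_abelianFourfold) (h02 : MoonenZarhin1999_codimTwoHodgeClasses_abelianFivefold)
    (hF : weilFamilyReach_similar) (hT : LocalVariationalHodgeFor 𝒪)
    (hS : ∀ n : ℕ, 2 ≤ n → ∀ d : ℕ, 0 < d → ∃ N : ℕ, n < N ∧ HasHyperbolicSeedOn 𝒪 N d) :
    WeilClassesImaginaryQuadratic ∧ Markman2025_weilClasses_algebraic_abelianFourfold ∧ Theses.SevenfoldWeilCensus.WeilSixfolds ∧
      NonsplitSixfolds ∧ SplitWeilAbelianVarieties ∧ Theses.SevenfoldWeilCensus.HodgeAbelianDimLeFive :=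
  ladder_of_moonenZarhinThms_of_reach_of_localVariationalHodgeFor_of_cofinalSeededMembers h01 h02 hF hT
    (cofinalSeededMembers_of_cofinalHyperbolicSeedsOn hS)

end Terminus

/-! ## §2 EXACTNESS: below dimension 6 the ladder's floor IS HC(dim ≤ 5), modulo Moonen–Zarhin Thm. 0.1 ∕ 0.2 -/

section Exactness

/-- **What any seed at any level buys below dimension 6 is EXACTLY HC(dim ≤ 5), modulo the two refereed facts** — for the cell's books: granted
`h01`, `h02` BY NAME, the FLOOR of the p11 ladder in the cell's per-`d` currency (`∀ d > 0, WeilAlgebraicAll 2 d`) is EQUIVALENT to the route item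
`Theses.SevenfoldWeilCensus.HodgeAbelianDimLeFive` (ring 2's `hodgeAbelianDimLeFive_iff_weilClassesFourfolds` through the kernel dictionary
`weilAlgebraicAll_two_iff_markman`). The printed remark that the hypothesis is not idle («in the cases (a), (b) and (c) the Weil classes are really
needed …», between Thms. (0.1) and (0.2)) is s4-bridge-3's record; an `↔` between OPEN statements under named facts — no case of HC is proved.
[cite: MoonenZarhin1999LowDim, Thm. 0.1, Thm. 0.2 and the remark after Thm. 0.1 (arXiv:math/9901113 pp. 1–3)] [cite: Markman2025SurveySecant, Cor. 1.3 (preprint)] -/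
theorem floor_iff_hodgeAbelianDimLeFive_of_moonenZarhinThms
    (h01 : MoonenZarhin1999_codimTwoHodgeClasses_abelianFourfold) (h02 : MoonenZarhin1999_codimTwoHodgeClasses_abelianFivefold) :
    (∀ d : ℕ, 0 < d → WeilAlgebraicAll 2 d) ↔ Theses.SevenfoldWeilCensus.HodgeAbelianDimLeFive :=
  weilAlgebraicAll_two_iff_markman.trans (hodgeAbelianDimLeFive_iff_weilClassesFourfolds h01 h02).symm

/-- **Conversely, HC(dim ≤ 5) gives back every FOURFOLD component `(2, d, δ)` — Moonen–Zarhin is NOT needed in this direction** (the on-path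
converse, for the books: `HodgeAbelianDimLeFive` ⟹ `HCUpToDim 5` ⟹ `HCAtDim 4` ⟹ Markman's fourfold statement ⟹ `WeilAlgebraicAll 2 d` for every
`d > 0` ⟹ every fourfold component, by ring 2's `hcUpToDim_five_iff_hodgeAbelianDimLeFive` ∕ `weilClassesFourfolds_of_hcAtDim_four` and the kernel
dictionary `weilAlgebraicAll_two_iff_markman` — tree theorems, no named fact; no level `N ≥ 3` component follows from `HodgeAbelianDimLeFive`).
[cite: vanGeemen1994HodgeAV, 4.14 and Lemma 5.2] [cite: MoonenZarhin1999LowDim, (1.9)] -/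
theorem fourfoldComponents_of_hodgeAbelianDimLeFive (h : Theses.SevenfoldWeilCensus.HodgeAbelianDimLeFive) {d : ℕ} (hd : 0 < d)
    (δ : weilNormResidueGroup d) : WeilClassesComponent 2 d δ :=
  weilClassesComponent_of_weilAlgebraicAll
    (weilAlgebraicAll_two_iff_markman.2
      (Ring2.ClassTargets.weilClassesFourfolds_of_hcAtDim_four (Ring2.ClassTargets.hcAtDim_of_hcUpToDim
        (Ring2.ClassTargets.hcUpToDim_mono (by norm_num) (Ring2.ClassTargets.hcUpToDim_five_iff_hodgeAbelianDimLeFive.2 h)))) d hd) δ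

end Exactness

/-! ## Audit: nothing is decided here
Every theorem with a Hodge conclusion carries among its hypotheses SEEDS (none on a deciding component in the signed census; nothing cofinal) AND,
BY NAME, the reach `weilFamilyReach_similar`, the transfer statement `LocalVariationalHodgeFor 𝒪` and Moonen–Zarhin's Thm. 0.1 ∕ Thm. 0.2
(codimension-2 parts, refereed, unproved in the tree) — or is an `↔` between open statements under those named facts, or (the last row) the
converse implication from the OPEN statement `HodgeAbelianDimLeFive` by tree theorems alone. `HC_CM`, CM density, Mumford–Tate finiteness do not occur;
NOT `HC_AV`. No definition, no named fact, no `sorry`. -/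

end Summit.Ventures.HSemireg

end
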